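import Summits.Ventures.Crystal3D.Bulk.GapReductionSharp
import Summits.Ventures.Crystal3D.Bulk.GapForms
import Literature.Geometry.DiscreteGeometry.KissingSearchFinal
import HarnessLib

/-!
# Bulk crystallization ⇐ GAP(1.26) alone (computational: the classification is the tree's
# verified search)

HONEST FRAMING. Part of the venture `Summits/Ventures/Crystal3D` (cell `pub-crystal3d`, phase 2,
`PLAN.md` R42.3 — the 24-hour decision sprint on GAP(h*), `h* = 1.26`; seat typer-bulk-2).
COMPUTATIONAL FILE: it imports `Literature/Geometry/DiscreteGeometry/KissingSearchFinal.lean`,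
whose `Hales2012_kissingConfigCongruent_holds` (Hales 2012, Theorem 3 + Lemmas 9–10: every
twelve-point configuration of Hales's class `𝒱` is congruent to the FCC or the HCP pattern) is
proved by a verified interval-arithmetic search run with `native_decide`; every theorem below
therefore depends on the 128 `native_decide` axioms of that run
(`KissingSearch.checkPart_eq_true_NNN._native.native_decide.ax_1_1`, compiler-trust class) in
addition to the standard three. With that
input the CLASSIFICATION half of the cell's reduction (`Bulk/GapReduction.lean`) is discharged at
Hales's gap `2h₀ = 2.52`, and bulk crystallization of sticky hard spheres becomes conditional on
the GAP statement ALONE — the one object the sprint certifies: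

  `TwelveNeighbourGap 1.26 → BulkCrystallization3D 702` (and `1296`),

where `TwelveNeighbourGap ρ` (seat typer-bulk, `Bulk/TwelveNeighbourGap.lean`; contact-distance-1
units, `ρ = h₀ = 1.26`) ⇔ `GapTupleDiam ρ` ⇔ `GapTuple (2ρ)` ⇔ `KissingGap (2ρ)`
(`Bulk/GapForms.lean`). Also recorded: the `flyspeck_L12`-conditional form with `K = 702`
(Hales's Lemma 1 gives the gap; `Bulk/TwelveNeighbourGap.lean`). NO unconditional crystallization
theorem is claimed: GAP(1.26) is, tonight, a census TARGET (in print it follows from Flyspeck's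
`L12`, or — at `1.2592` — from Böröczky–Szabó 2015, Theorem 3).
-/

noncomputable section

namespace Summit.Ventures.Crystal3D

open Literature.Geometry.DiscreteGeometry

/-- **CLASSIFICATION(2h₀) holds** (computationally): the tree's verified search
`Hales2012_kissingConfigCongruent_holds`, read through `kissingClassification_two_mul_hales_h0_iff`.
Axioms: standard + the run's `native_decide` axioms. -/
theorem kissingClassification_two_mul_hales_h0_holds : KissingClassification (2 * hales_h0) :=
  kissingClassification_two_mul_hales_h0_iff.2 Hales2012_kissingConfigCongruent_holds

/-- **GAP(1.26) ⇒ `L12Local`** (computational). -/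
theorem l12Local_of_twelveNeighbourGap (h : TwelveNeighbourGap hales_h0) : L12Local :=
  l12Local_of_gap_of_classification (kissingGap_of_twelveNeighbourGap h)
    kissingClassification_two_mul_hales_h0_holds

/-- **GAP(1.26) ⇒ bulk crystallization, `K = 1296`** (computational; PLAN R42.3): if every
twelve-coordinated ball of every finite unit packing in `ℝ³` has all other centres at distance `1`
or `≥ 1.26`, then in every sticky ground state of `N` balls all but `≤ 1296·N^{2/3}` balls have
an FCC or HCP first shell. -/
theorem bulkCrystallization3D_of_twelveNeighbourGap (h : TwelveNeighbourGap hales_h0) :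
    BulkCrystallization3D 1296 :=
  bulkCrystallization3D_of_gap_of_classification (kissingGap_of_twelveNeighbourGap h)
    kissingClassification_two_mul_hales_h0_holds

/-- **GAP(1.26) ⇒ bulk crystallization, `K = 702`** (computational; all-but-one form,
`Bulk/GapReductionSharp.lean`). -/
theorem bulkCrystallization3D_sharp_of_twelveNeighbourGap (h : TwelveNeighbourGap hales_h0) :
    BulkCrystallization3D 702 :=
  bulkCrystallization3D_sharp_of_gap_of_classification (kissingGap_of_twelveNeighbourGap h)
    kissingClassification_two_mul_hales_h0_holds

/-- **The same from the fourteen-ball form** the engines certify (`GapTupleDiam 1.26`,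
contact-distance-1 units). -/
theorem bulkCrystallization3D_sharp_of_gapTupleDiam_hales_h0 (h : GapTupleDiam hales_h0) :
    BulkCrystallization3D 702 :=
  bulkCrystallization3D_sharp_of_twelveNeighbourGap (twelveNeighbourGap_of_gapTupleDiam h)

/-- **The same from the radius-one fourteen-ball form** (`GapTuple 2.52`, Hales's units). -/
theorem bulkCrystallization3D_sharp_of_gapTuple_252 (h : GapTuple 2.52) :
    BulkCrystallization3D 702 := by
  rw [← two_mul_hales_h0] at h
  exact bulkCrystallization3D_sharp_of_twelveNeighbourGap
    ((gapTuple_iff_twelveNeighbourGap hales_h0).1 h)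

/-- **Flyspeck-conditional bulk crystallization with `K = 702`** (computational on the
classification side): Hales's Lemma 1 (`flyspeck_L12`) gives GAP(1.26)
(`twelveNeighbourGap_of_L12`), hence `BulkCrystallization3D 702`. Trust base:
{`flyspeck_L12`} + the run's `native_decide` axioms. -/
theorem bulkCrystallization3D_sharp_of_flyspeck_L12 (hL12 : flyspeck_L12) :
    BulkCrystallization3D 702 :=
  bulkCrystallization3D_sharp_of_twelveNeighbourGap (twelveNeighbourGap_of_L12 hL12)

/-- GAP(1.26) is refutable only below the intruder: the sprint's target sits at `1.26`, inside
`(1, 7√3/9)` where neither the trivial truth (`ρ ≤ 1`) nor the kernel refutation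
(`not_twelveNeighbourGap_of_lt`, `ρ > 7√3/9 = 1.3471…`) applies. -/
theorem hales_h0_lt_intruder : hales_h0 < 7 * Real.sqrt 3 / 9 := by
  rw [hales_h0_eq]
  linarith [Intruder.seven_sqrt_three_div_nine_bounds.1]

end Summit.Ventures.Crystal3D

end
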